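import Literature.IUT.HodgeArakelov.BadPlaceSettingOfUnderline
import Literature.IUT.HodgeArakelov.BadPlaceSettingOfDoubleUnderlineLevels
import Literature.IUT.HodgeArakelov.LabelClassesOfCusps

/-!
# [IUTchII] Def. 2.3 (i): the index `[Π^±_v : Π_v]` of ANY `±`-tower is the index `[Π^tp_{X_v} : Π_v]` of the setting —
# hence `= l` over the print-level model `X̲_v` and `= l²` over the `(1,1)`-curve model (conjunct 3 of `Def23_i_indices` decided)

S. Mochizuki, *Inter-universal Teichmüller theory II*, kurims manuscript (Dec. 2020), §2, Def. 2.3 (i) p. 67 ("`Π^±_v/Π_v ⥲ … ≅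
Gal(X̲̲_v/X_v) (≅ ℤ/lℤ)`") ([IUTchII] Def 2.3 (i), kurims p.67) [claim: Mochizuki2012, status: disputed] (D-0012 claim key; series status
DISPUTED — elementary index bookkeeping over the typed interfaces; nothing of the series is asserted).  abc-iut cell, seat abc-iut-L6-t19
gen 5 (RQ7 audit slice; follow-through of finding F-L6t19g5-1).  PROOF-ONLY (0 defs).

* `PlusMinusTower.index_piV_subgroupOf_piPM` — for EVERY tower `W : PlusMinusTower T` (abc-iut-L6-t1), `[Π^±_v : Π_v] = [Π^tp_{X_v}(P) : incl P]`
  (`emb` is injective), and `TemperedCoverings.index_range_incl` — `[Π^tp_{X_v}(P) : incl P] = [Π^tp_{X_v} : inclPlain Π_v]` of the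
  `BadPlaceSetting` (the field `corresponds`); so conjunct 3 of abc-iut-L6-t1's `Def23_i_indices` («`(W.piV.subgroupOf W.piPM).index = S.l`»)
  depends on the SETTING ONLY, never on the tower or the decomposition;
* over the print-level [EtTh] model `BadPlaceSetting.ofUnderline` (p420095, `Π^tp_{X_v} := Π^tp_{X̲_v}`): `= l` for every tower —
  **conjunct 3 of `Def23_i_indices` HOLDS identically** (`index_piV_subgroupOf_piPM_ofUnderline`);
* over w4-d034's `BadPlaceSetting.ofDoubleUnderline` (p413302, `Π^tp_{X_v} :=` the `(1,1)` curve's `Π^tp_X`): `= l²` for every tower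
  (p419404), hence **`¬ Def23_i_indices Dec W` for EVERY decomposition and EVERY tower over that model** (`l` prime, `l² ≠ l`) —
  the kernel form of finding F-L6t19g5-1 (any discharge over that model taking `Def23_i_indices` as a hypothesis is vacuous there; the
  print-level routes p420686 are over `ofUnderline`).

Nothing here takes a side on [IUTchIII] Cor. 3.12; typed ≠ proved; audited ≠ endorsed.
-/

namespace Literature.IUT.HodgeArakelov

open Literature.AnabelianGeometry.EtaleTheta

universe u

namespace TemperedCoverings

variable {S : BadPlaceSetting.{u}} {P : TopGroup.{u}} (T : TemperedCoverings S P)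

/-- **`[Π^tp_{X_v}(P) : incl(P)] = [Π^tp_{X_v} : inclPlain(Π_v)]`**: the index of the vertical arrow of a Prop. 2.1 output equals that of the
reference diagram (transport along the identifications of the field `corresponds`).  PROVED.
([IUTchII] Prop 2.1, kurims p.65) [claim: Mochizuki2012, status: disputed] -/
theorem index_range_incl : T.incl.range.index = S.inclPlain.range.index := by
  obtain ⟨e, e', hcomm, -, -⟩ := T.corresponds
  have hc : e'.toMulEquiv.toMonoidHom.comp T.incl = S.inclPlain.comp e.toMulEquiv.toMonoidHom :=
    MonoidHom.ext fun x => hcomm x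
  have h : T.incl.range.map e'.toMulEquiv.toMonoidHom = S.inclPlain.range := by
    rw [← MonoidHom.range_comp, hc, MonoidHom.range_comp, MonoidHom.range_eq_top.mpr e.surjective,
      ← MonoidHom.range_eq_map]
  rw [← h, Subgroup.index_map_of_bijective e'.bijective]

end TemperedCoverings

namespace PlusMinusTower

variable {S : BadPlaceSetting.{u}} {P : TopGroup.{u}} {T : TemperedCoverings S P} (W : PlusMinusTower T)

/-- **`[Π^±_v : Π_v] = [Π^tp_{X_v}(P) : incl(P)]`** inside `Π̂^cor_v`, for EVERY `±`-tower (`emb` is injective).  PROVED.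
([IUTchII] Def 2.3 (i), kurims p.67) [claim: Mochizuki2012, status: disputed] -/
theorem index_piV_subgroupOf_piPM : (W.piV.subgroupOf W.piPM).index = T.incl.range.index := by
  change W.piV.relIndex W.piPM = _
  rw [show W.piV = T.incl.range.map W.emb from MonoidHom.range_comp _ _,
    show W.piPM = (⊤ : Subgroup T.Xplain).map W.emb from MonoidHom.range_eq_map _,
    Subgroup.relIndex_map_map_of_injective _ _ W.emb_injective, Subgroup.relIndex_top_right]

/-- **`[Π^±_v : Π_v] = [Π^tp_{X_v} : inclPlain(Π_v)]` of the setting**, for every tower — conjunct 3 of `Def23_i_indices` depends on `S` only.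
PROVED. ([IUTchII] Def 2.3 (i), kurims p.67) [claim: Mochizuki2012, status: disputed] -/
theorem index_piV_subgroupOf_piPM_eq : (W.piV.subgroupOf W.piPM).index = S.inclPlain.range.index := by
  rw [W.index_piV_subgroupOf_piPM, T.index_range_incl]

/-- Conjunct 3 of `Def23_i_indices` for one tower implies it for every tower over the same setting.  PROVED.
([IUTchII] Def 2.3 (i), kurims p.67) [claim: Mochizuki2012, status: disputed] -/
theorem index_piV_subgroupOf_piPM_congr {P' : TopGroup.{u}} {T' : TemperedCoverings S P'} (W' : PlusMinusTower T') :
    (W.piV.subgroupOf W.piPM).index = (W'.piV.subgroupOf W'.piPM).index := by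
  rw [W.index_piV_subgroupOf_piPM_eq, W'.index_piV_subgroupOf_piPM_eq]

end PlusMinusTower

/-! ## The two [EtTh] models -/

section Models

variable {p : ℕ} [Fact p.Prime] {D : Literature.AnabelianGeometry.EtaleTheta.ThetaSetting p} {E : D.EtaleThetaData} {l : ℕ} (C : E.DoubleUnderline l) {N : ℕ+}
  (μ : D.CyclotomeMod l N) (hC : D.Compat) (hS : D.Sec2Hyps) (hl : l.Prime) (hp2 : p ≠ 2) (hpl : p ≠ l)
  (hζ : ∃ ζ : D.K, IsPrimitiveRoot ζ (4 * l)) {η : (C.thetaEnvData μ hC hS).PiYdd → MuN p N}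
  (hη : η ∈ (C.thetaEnvData μ hC hS).thetaCocycles)

/-- **Over the print-level model `X̲_v` (p420095), `[Π^±_v : Π_v] = l` for EVERY tower** — conjunct 3 of abc-iut-L6-t1's `Def23_i_indices`
holds identically there (abc-iut-L2-t8's `relIndex_Huu_GtpXu` through `ofUnderline_index_eq`).  PROVED.
([IUTchII] Def 2.3 (i), kurims p.67) [claim: Mochizuki2012, status: disputed] -/
theorem PlusMinusTower.index_piV_subgroupOf_piPM_ofUnderline {P : TopGroup.{0}}
    {T : TemperedCoverings (BadPlaceSetting.ofUnderline C μ hC hS hl hp2 hpl hζ hη) P} (W : PlusMinusTower T) :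
    (W.piV.subgroupOf W.piPM).index = l := by
  rw [W.index_piV_subgroupOf_piPM_eq]
  exact BadPlaceSetting.ofUnderline_index_eq C μ hC hS hl hp2 hpl hζ hη

/-- Hence over the print-level model conjunct 3 of `Def23_i_indices` reads `l = S.l`, which holds (`S.l = l` by construction).  PROVED.
([IUTchII] Def 2.3 (i), kurims p.67) [claim: Mochizuki2012, status: disputed] -/
theorem PlusMinusTower.index_piV_subgroupOf_piPM_ofUnderline_eq_l {P : TopGroup.{0}}
    {T : TemperedCoverings (BadPlaceSetting.ofUnderline C μ hC hS hl hp2 hpl hζ hη) P} (W : PlusMinusTower T) :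
    (W.piV.subgroupOf W.piPM).index = (BadPlaceSetting.ofUnderline C μ hC hS hl hp2 hpl hζ hη).l :=
  W.index_piV_subgroupOf_piPM_ofUnderline C μ hC hS hl hp2 hpl hζ hη

/-- **Over w4-d034's `(1,1)`-curve model (p413302), `[Π^±_v : Π_v] = l²` for EVERY tower** (p419404 `ofDoubleUnderline_index_eq_sq`).  PROVED.
([IUTchII] Def 2.3 (i), kurims p.67) [claim: Mochizuki2012, status: disputed] -/
theorem PlusMinusTower.index_piV_subgroupOf_piPM_ofDoubleUnderline {P : TopGroup.{0}}
    {T : TemperedCoverings (BadPlaceSetting.ofDoubleUnderline C μ hC hS hl hp2 hpl hζ hη) P} (W : PlusMinusTower T) :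
    (W.piV.subgroupOf W.piPM).index = l ^ 2 := by
  rw [W.index_piV_subgroupOf_piPM_eq]
  exact BadPlaceSetting.ofDoubleUnderline_index_eq_sq C μ hC hS hl hp2 hpl hζ hη

/-- **Kernel form of finding F-L6t19g5-1**: over the `(1,1)`-curve model `BadPlaceSetting.ofDoubleUnderline`, abc-iut-L6-t1's predicate
`Def23_i_indices Dec W` FAILS for every subgraph decomposition `Dec` and every `±`-tower `W` (its conjunct 3 demands `[Π^±_v : Π_v] = l`,
the model gives `l²`, and `l` is prime) — every statement over that model hypothesising `Def23_i_indices` is vacuously true there; the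
print-level model `ofUnderline` is the repair.  PROVED. ([IUTchII] Def 2.3 (i), kurims p.67) [claim: Mochizuki2012, status: disputed] -/
theorem not_def23_i_indices_ofDoubleUnderline {P : TopGroup.{0}}
    {T : TemperedCoverings (BadPlaceSetting.ofDoubleUnderline C μ hC hS hl hp2 hpl hζ hη) P}
    {D' : EtaleThetaData (BadPlaceSetting.ofDoubleUnderline C μ hC hS hl hp2 hpl hζ hη).toThetaSetting P}
    (Dec : SubgraphDecomposition _ T D') (W : PlusMinusTower T) : ¬ Def23_i_indices Dec W := by
  intro h
  have h3 : (W.piV.subgroupOf W.piPM).index = l := (h Dec.Pbullet (Set.mem_insert _ _)).2.2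
  rw [W.index_piV_subgroupOf_piPM_ofDoubleUnderline C μ hC hS hl hp2 hpl hζ hη] at h3
  have h1 : l * l = l * 1 := by rw [mul_one, ← sq, h3]
  exact absurd (Nat.eq_of_mul_eq_mul_left hl.pos h1) hl.one_lt.ne'

/-- … while over the print-level model the same conjunct is no obstruction: `Def23_i_indices Dec W` is equivalent to its first two
conjuncts there.  PROVED. ([IUTchII] Def 2.3 (i), kurims p.67) [claim: Mochizuki2012, status: disputed] -/
theorem def23_i_indices_ofUnderline_iff {P : TopGroup.{0}}
    {T : TemperedCoverings (BadPlaceSetting.ofUnderline C μ hC hS hl hp2 hpl hζ hη) P}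
    {D' : EtaleThetaData (BadPlaceSetting.ofUnderline C μ hC hS hl hp2 hpl hζ hη).toThetaSetting P}
    (Dec : SubgraphDecomposition _ T D') (W : PlusMinusTower T) :
    Def23_i_indices Dec W ↔
      ∀ H ∈ ({Dec.Pbullet, Dec.Ptri} : Set (Subgroup P)),
        W.pmNormalizer H ⊓ W.piV = H.map (W.emb.comp T.incl) ∧
        ((H.map (W.emb.comp T.incl)).subgroupOf (W.pmNormalizer H)).index =
          (BadPlaceSetting.ofUnderline C μ hC hS hl hp2 hpl hζ hη).l := by
  refine ⟨fun h H hH => ⟨(h H hH).1, (h H hH).2.1⟩, fun h H hH => ⟨(h H hH).1, (h H hH).2, ?_⟩⟩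
  exact W.index_piV_subgroupOf_piPM_ofUnderline_eq_l C μ hC hS hl hp2 hpl hζ hη

end Models

end Literature.IUT.HodgeArakelov
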